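/-
COR-CM (cell pub-hodgecm2, stage 2 of the Hodge ladder) — count-neutral KERNEL COMBINATORICS «the abelian slices, datum-free»
(seat prover-pub-hodgecm2-b23-g39-0, binder prover b23, gen 39; claim ABELIAN-DATUM D2, HOME/INBOX.md l.9432).  Theorems only: the
datum of `CorCM/FaceAbelianDatum.lean` (D1) fed into this seat's slice transports (`Census/OddSliceFaceTransport.lean`, gen 36;
`Census/EvenSliceFaceTransport.lean`, gen 37) BY NAME; no geometry, no named fact, nothing asserted; `Interfaces.lean` (C1), every E term,
B01 and `Transposition/*` are untouched.
HONEST FRAMING (COORDINATOR RULING — HODGE FRAMING CORRECTION, 2026-08-21T11:55:35Z): `HC_CM` is NOT proved, here or anywhere in the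
tree; every `HodgeConjectureFor` below is CONDITIONAL on face periods; no period is produced.
T5: n/a-class — the only Prop hypothesis binder on an HC-level conclusion is INT2-GEN's period hypothesis on the produced face set (the
group-theoretic hypotheses are decidable data about `Aut(K)` / `(ℤ/N)ˣ`); checker: self (prover-pub-hodgecm2-b23-g39-0), 2026-08-22.
-/
import Summits.HodgeConjecture.CorCM.FaceAbelianDatum
import Summits.HodgeConjecture.CorCM.Census.OddSliceFaceTransport
import Summits.HodgeConjecture.CorCM.Census.EvenSliceFaceTransport
import HarnessLib

/-!
# The abelian slices, datum-free: face sets for Galois CM fields with commutative `Aut` and non-square complex conjugation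

Gens 36/37 of this seat transported seat b09's slice models to the tree UNDER AN `Aut`-DATUM `ε : Aut(K) ≃ ℤ/2 × A`
(`exists_faceSet_oddSliceFamily_aut`: `|A|` odd `≥ 3`, at most `#OrbitsA A` faces; `exists_faceSet_evenSliceSquares_aut`: `|A|` even `≥ 4`,
at most `#OrbitsA A − 1` faces).  With D1 (`FaceAbelian.exists_autDatum_of_not_isSquare`) the datum is now CONSTRUCTED from:
commutativity of `Aut(K)`, the conjugation automorphism `c` at `σ₀` being a NON-SQUARE, and any presentation `π : Aut(K) ↠ A` of
`Aut(K)/⟨c⟩` (additive on products, `π c = 0`, kernel `{1, c}`, onto).  Hence: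

* §1 `exists_faceSet_oddSlice_of_presentation` / `exists_faceSet_evenSlice_of_presentation`: the two slice theorems with the datum
  replaced by (commutative `Aut`, `¬ IsSquare c`, presentation); for `[K:ℚ]/2` odd the non-square hypothesis is automatic
  (`exists_faceSet_oddSlice_of_presentation'`, D1 `not_isSquare_conjAut_of_odd`).
* §2 CYCLOTOMIC FIELDS `ℚ(ζ_N)` (`exists_faceSet_oddSlice_cyclotomic_of_unitTable` / `exists_faceSet_evenSlice_cyclotomic_of_unitTable`):
  ALL group hypotheses become decidable statements about `(ℤ/N)ˣ` — `∀ r, r·r ≠ −1` (complex conjugation `= −1` under `autEquivPow`,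
  D1 `autEquivPow_conjAut`) and a unit table `t : (ℤ/N)ˣ → A` (additive, `t(−1) = 0`, kernel `{±1}`, onto) — so a named composite
  cyclotomic field costs four `decide`s (sequel `CorCM/FaceCyclotomicComposite.lean`: `ℚ(ζ₁₅), ℚ(ζ₁₆), ℚ(ζ₂₀), ℚ(ζ₂₁), ℚ(ζ₂₄), ℚ(ζ₂₈)`).
  Also the packaged datum `exists_autDatum_cyclotomic_of_unitTable` for use with gen 37's numeric instances
  (`exists_faceSet_evenSlice_zmod_four` …).

Every conclusion: a finite face set `𝒮` of `K` of the stated size EXISTS such that ONE period witness per face of `𝒮` on the universe of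
record implies the Hodge conjecture, in every codimension, for every complex abelian variety dominated by a finite product of abelian
varieties realising CM types of CM fields embeddable in `K` — CONDITIONAL; `HC_CM` is NOT proved, no period is produced.

References: [cite: Washington1997, Thm. 2.5]; [cite: Pohlmann1968, Thm. 1]; [cite: Milne1999LefschetzClasses, Thm. 3.2 and Cor. 4.5];
[cite: Shimura1998, §6.2 Theorem 3 and §6.1 Corollary of Theorem 2 (pp. 41–43)]; [cite: MumfordAV1970, §19 Thm. 1 and p. 169].
-/

noncomputable section

open CategoryTheory NumberField NumberField.ComplexEmbedding
open Literature.AlgebraicGeometry Literature.AlgebraicGeometry.Motives Literature.AlgebraicGeometry.HodgeTheory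
open Literature.AlgebraicGeometry.ComplexMultiplication Literature.AlgebraicGeometry.Milne1999
open Literature.NumberTheory.Automorphic
open Literature.NumberTheory.Automorphic.PicardCM
open Summit.HodgeConjecture.CorCM.Domination

namespace Summit.HodgeConjecture.CorCM.FaceAbelian

open Summit.HodgeConjecture.CorCM.Census.OddDegreeParityLaw (OrbitsA)

/-! ## §1 The slices from (commutative `Aut`, non-square conjugation, presentation) -/

section Presentation

variable {A : Type} [AddCommGroup A] [Fintype A] [DecidableEq A]

/-- **THE ODD SLICE, DATUM-FREE.**  `K` Galois CM with commutative `Aut(K)`; `c` the conjugation automorphism at `σ₀`, not a square;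
`π : Aut(K) ↠ A` a presentation of `Aut(K)/⟨c⟩` with `|A|` odd `≥ 3`: at most `#OrbitsA A` faces whose periods give HC of the slice.
[cite: Shimura1998, §6.2 Theorem 3 and §6.1 Corollary of Theorem 2 (pp. 41–43)] [cite: Pohlmann1968, Thm. 1]
[cite: Milne1999LefschetzClasses, Thm. 3.2 and Cor. 4.5] [cite: MumfordAV1970, §19 Thm. 1 and p. 169] -/
theorem exists_faceSet_oddSlice_of_presentation (K : CMField) [hGal : IsGalois ℚ K]
    (hcomm : ∀ g h : ((K : Type) ≃ₐ[ℚ] (K : Type)), g * h = h * g) (σ₀ : (K : Type) →+* ℂ)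
    {c : ((K : Type) ≃ₐ[ℚ] (K : Type))} (hcσ : σ₀.comp (c : (K : Type) →+* (K : Type)) = conjugate σ₀) (hns : ¬ IsSquare c)
    (π : ((K : Type) ≃ₐ[ℚ] (K : Type)) → A) (hπ : ∀ g h, π (g * h) = π g + π h) (hπc : π c = 0)
    (hker : ∀ g, π g = 0 → g = 1 ∨ g = c) (hsurj : Function.Surjective π) (hA : Odd (Fintype.card A)) (h3 : 3 ≤ Fintype.card A) :
    ∃ 𝒮 : Finset (Face K), 𝒮.card ≤ Fintype.card (OrbitsA A) ∧
      ((∀ f ∈ 𝒮, ∃ ι₁ : K →+* ℂ, f.Admissible ι₁ ∧ ∃ (V : HermSpace3 K ι₁) (σ : K →+* ℂ),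
        (Model.picardCMUniverse exists_isReal_hodgeModel_holds hodgePQ_independent_of_hodgeModel_holds
          BallQuotient.ballQuotientUniformised_holds cmAbelianVarietyRealised_holds).PeriodNV ι₁ V K f.psi σ) →
      ∀ {P B : AbelianVariety ℂ}, AbelianVariety.IsProductOf (fun B : AbelianVariety ℂ =>
        ∃ (E : Type) (_ : Field E) (_ : NumberField E) (_ : IsCMField E) (_ : E →+* (K : Type)) (Φ : CMType E)
          (ι : 𝓞 E →+* End B) (θ : E →+* Module.End ℂ (complexBetti B.X 1)),
          IsCMTypeRealisation Φ B ι θ) P →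
      AVDominatedBy B P → HodgeConjectureFor B.dim B.X) := by
  obtain ⟨ε, hε, hεc⟩ := exists_autDatum_of_not_isSquare hcomm hns π hπ hπc hker hsurj
  exact exists_faceSet_oddSliceFamily_aut K hA h3 σ₀ ε hε hcσ hεc

/-- **THE ODD SLICE, DATUM-FREE, `[K:ℚ] = 2|A|` with `|A|` odd**: the non-square hypothesis is automatic (D1 `not_isSquare_conjAut_of_odd`).
[cite: Shimura1998, §6.2 Theorem 3 and §6.1 Corollary of Theorem 2 (pp. 41–43)] [cite: Pohlmann1968, Thm. 1]
[cite: Milne1999LefschetzClasses, Thm. 3.2 and Cor. 4.5] [cite: MumfordAV1970, §19 Thm. 1 and p. 169] -/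
theorem exists_faceSet_oddSlice_of_presentation' (K : CMField) [hGal : IsGalois ℚ K]
    (hcomm : ∀ g h : ((K : Type) ≃ₐ[ℚ] (K : Type)), g * h = h * g) (σ₀ : (K : Type) →+* ℂ)
    {c : ((K : Type) ≃ₐ[ℚ] (K : Type))} (hcσ : σ₀.comp (c : (K : Type) →+* (K : Type)) = conjugate σ₀)
    (hK : Module.finrank ℚ (K : Type) = 2 * Fintype.card A)
    (π : ((K : Type) ≃ₐ[ℚ] (K : Type)) → A) (hπ : ∀ g h, π (g * h) = π g + π h) (hπc : π c = 0)
    (hker : ∀ g, π g = 0 → g = 1 ∨ g = c) (hsurj : Function.Surjective π) (hA : Odd (Fintype.card A)) (h3 : 3 ≤ Fintype.card A) :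
    ∃ 𝒮 : Finset (Face K), 𝒮.card ≤ Fintype.card (OrbitsA A) ∧
      ((∀ f ∈ 𝒮, ∃ ι₁ : K →+* ℂ, f.Admissible ι₁ ∧ ∃ (V : HermSpace3 K ι₁) (σ : K →+* ℂ),
        (Model.picardCMUniverse exists_isReal_hodgeModel_holds hodgePQ_independent_of_hodgeModel_holds
          BallQuotient.ballQuotientUniformised_holds cmAbelianVarietyRealised_holds).PeriodNV ι₁ V K f.psi σ) →
      ∀ {P B : AbelianVariety ℂ}, AbelianVariety.IsProductOf (fun B : AbelianVariety ℂ =>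
        ∃ (E : Type) (_ : Field E) (_ : NumberField E) (_ : IsCMField E) (_ : E →+* (K : Type)) (Φ : CMType E)
          (ι : 𝓞 E →+* End B) (θ : E →+* Module.End ℂ (complexBetti B.X 1)),
          IsCMTypeRealisation Φ B ι θ) P →
      AVDominatedBy B P → HodgeConjectureFor B.dim B.X) :=
  exists_faceSet_oddSlice_of_presentation K hcomm σ₀ hcσ (not_isSquare_conjAut_of_odd σ₀ hcσ hA hK) π hπ hπc hker hsurj hA h3

/-- **THE EVEN SLICE, DATUM-FREE.**  Same hypotheses with `|A|` even `≥ 4`: a face set `𝒮` with `|𝒮| + 1 ≤ #OrbitsA A` whose periods give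
HC of the slice.
[cite: Shimura1998, §6.2 Theorem 3 and §6.1 Corollary of Theorem 2 (pp. 41–43)] [cite: Pohlmann1968, Thm. 1]
[cite: Milne1999LefschetzClasses, Thm. 3.2 and Cor. 4.5] [cite: MumfordAV1970, §19 Thm. 1 and p. 169] -/
theorem exists_faceSet_evenSlice_of_presentation (K : CMField) [hGal : IsGalois ℚ K]
    (hcomm : ∀ g h : ((K : Type) ≃ₐ[ℚ] (K : Type)), g * h = h * g) (σ₀ : (K : Type) →+* ℂ)
    {c : ((K : Type) ≃ₐ[ℚ] (K : Type))} (hcσ : σ₀.comp (c : (K : Type) →+* (K : Type)) = conjugate σ₀) (hns : ¬ IsSquare c)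
    (π : ((K : Type) ≃ₐ[ℚ] (K : Type)) → A) (hπ : ∀ g h, π (g * h) = π g + π h) (hπc : π c = 0)
    (hker : ∀ g, π g = 0 → g = 1 ∨ g = c) (hsurj : Function.Surjective π) (hA : Even (Fintype.card A)) (h4 : 4 ≤ Fintype.card A) :
    ∃ 𝒮 : Finset (Face K), 𝒮.card + 1 ≤ Fintype.card (OrbitsA A) ∧
      ((∀ f ∈ 𝒮, ∃ ι₁ : K →+* ℂ, f.Admissible ι₁ ∧ ∃ (V : HermSpace3 K ι₁) (σ : K →+* ℂ),
        (Model.picardCMUniverse exists_isReal_hodgeModel_holds hodgePQ_independent_of_hodgeModel_holds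
          BallQuotient.ballQuotientUniformised_holds cmAbelianVarietyRealised_holds).PeriodNV ι₁ V K f.psi σ) →
      ∀ {P B : AbelianVariety ℂ}, AbelianVariety.IsProductOf (fun B : AbelianVariety ℂ =>
        ∃ (E : Type) (_ : Field E) (_ : NumberField E) (_ : IsCMField E) (_ : E →+* (K : Type)) (Φ : CMType E)
          (ι : 𝓞 E →+* End B) (θ : E →+* Module.End ℂ (complexBetti B.X 1)),
          IsCMTypeRealisation Φ B ι θ) P →
      AVDominatedBy B P → HodgeConjectureFor B.dim B.X) := by
  obtain ⟨ε, hε, hεc⟩ := exists_autDatum_of_not_isSquare hcomm hns π hπ hπc hker hsurj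
  exact exists_faceSet_evenSliceSquares_aut K hA h4 σ₀ ε hε hcσ hεc

end Presentation

/-! ## §2 Cyclotomic fields: every hypothesis a statement about `(ℤ/N)ˣ` -/

section Cyclotomic

variable {A : Type} [AddCommGroup A] [Fintype A] [DecidableEq A] {N : ℕ} [NeZero N]

omit [Fintype A] [DecidableEq A] in
/-- **The `Aut`-datum of `ℚ(ζ_N)` from a unit table.**  `K` an `N`-th cyclotomic extension of `ℚ`, `−1` a non-square unit mod `N`
(`∀ r, r·r ≠ −1`), `t : (ℤ/N)ˣ → A` additive on products with `t(−1) = 0`, kernel `{±1}`, onto: for every complex embedding `σ₀` there are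
the conjugation automorphism `c` at `σ₀` and a bijection `ε : Aut(K) ≃ ℤ/2 × A`, multiplicative-to-additive, with `ε c = (1, 0)` — the input
of gens 36/37's `_aut` theorems and numeric instances. [cite: Washington1997, Thm. 2.5] -/
theorem exists_autDatum_cyclotomic_of_unitTable (K : Type) [Field K] [NumberField K] [IsCyclotomicExtension {N} ℚ K]
    (hN : ∀ r : (ZMod N)ˣ, r * r ≠ -1) (t : (ZMod N)ˣ → A) (ht : ∀ u v, t (u * v) = t u + t v) (ht1 : t (-1) = 0)
    (htker : ∀ u, t u = 0 → u = 1 ∨ u = -1) (htsurj : Function.Surjective t) (σ₀ : K →+* ℂ) :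
    ∃ (c : K ≃ₐ[ℚ] K) (ε : (K ≃ₐ[ℚ] K) ≃ ZMod 2 × A), σ₀.comp (c : K →+* K) = conjugate σ₀ ∧
      (∀ g h, ε (g * h) = ε g + ε h) ∧ ε c = (1, 0) := by
  haveI := IsCyclotomicExtension.isGalois {N} ℚ K
  obtain ⟨c, hcσ⟩ := FaceCensus.exists_conjAut σ₀
  obtain ⟨hπ, hπc, hker, hsurj⟩ := presentation_of_unitTable σ₀ hcσ t ht ht1 htker htsurj
  obtain ⟨ε, hε, hεc⟩ := exists_autDatum_of_not_isSquare (aut_mul_comm_of_isCyclotomicExtension (n := N))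
    (not_isSquare_conjAut_of_isCyclotomicExtension σ₀ hcσ hN) _ hπ hπc hker hsurj
  exact ⟨c, ε, hcσ, hε, hεc⟩

/-- **THE ODD SLICE OF `ℚ(ζ_N)` FROM A UNIT TABLE** (`|A|` odd `≥ 3`; e.g. `N = p ≡ 3 (mod 4)` prime with `t` the quotient by `±1`):
at most `#OrbitsA A` faces whose periods give HC of the slice.  CONDITIONAL; `HC_CM` is NOT proved.
[cite: Washington1997, Thm. 2.5] [cite: Shimura1998, §6.2 Theorem 3 and §6.1 Corollary of Theorem 2 (pp. 41–43)]
[cite: Pohlmann1968, Thm. 1] [cite: Milne1999LefschetzClasses, Thm. 3.2 and Cor. 4.5] [cite: MumfordAV1970, §19 Thm. 1 and p. 169] -/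
theorem exists_faceSet_oddSlice_cyclotomic_of_unitTable (K : CMField) [IsCyclotomicExtension {N} ℚ (K : Type)]
    (hN : ∀ r : (ZMod N)ˣ, r * r ≠ -1) (t : (ZMod N)ˣ → A) (ht : ∀ u v, t (u * v) = t u + t v) (ht1 : t (-1) = 0)
    (htker : ∀ u, t u = 0 → u = 1 ∨ u = -1) (htsurj : Function.Surjective t) (hA : Odd (Fintype.card A)) (h3 : 3 ≤ Fintype.card A)
    (σ₀ : (K : Type) →+* ℂ) :
    ∃ 𝒮 : Finset (Face K), 𝒮.card ≤ Fintype.card (OrbitsA A) ∧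
      ((∀ f ∈ 𝒮, ∃ ι₁ : K →+* ℂ, f.Admissible ι₁ ∧ ∃ (V : HermSpace3 K ι₁) (σ : K →+* ℂ),
        (Model.picardCMUniverse exists_isReal_hodgeModel_holds hodgePQ_independent_of_hodgeModel_holds
          BallQuotient.ballQuotientUniformised_holds cmAbelianVarietyRealised_holds).PeriodNV ι₁ V K f.psi σ) →
      ∀ {P B : AbelianVariety ℂ}, AbelianVariety.IsProductOf (fun B : AbelianVariety ℂ =>
        ∃ (E : Type) (_ : Field E) (_ : NumberField E) (_ : IsCMField E) (_ : E →+* (K : Type)) (Φ : CMType E)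
          (ι : 𝓞 E →+* End B) (θ : E →+* Module.End ℂ (complexBetti B.X 1)),
          IsCMTypeRealisation Φ B ι θ) P →
      AVDominatedBy B P → HodgeConjectureFor B.dim B.X) := by
  haveI : IsGalois ℚ (K : Type) := IsCyclotomicExtension.isGalois {N} ℚ (K : Type)
  obtain ⟨c, ε, hcσ, hε, hεc⟩ := exists_autDatum_cyclotomic_of_unitTable (K : Type) hN t ht ht1 htker htsurj σ₀
  exact exists_faceSet_oddSliceFamily_aut K hA h3 σ₀ ε hε hcσ hεc

/-- **THE EVEN SLICE OF `ℚ(ζ_N)` FROM A UNIT TABLE** (`|A|` even `≥ 4`; `4 ∣ N`, or `N` with a prime factor `≡ 3 (mod 4)` and `φ(N)/2`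
even): a face set `𝒮` with `|𝒮| + 1 ≤ #OrbitsA A` whose periods give HC of the slice.  CONDITIONAL; `HC_CM` is NOT proved.
[cite: Washington1997, Thm. 2.5] [cite: Shimura1998, §6.2 Theorem 3 and §6.1 Corollary of Theorem 2 (pp. 41–43)]
[cite: Pohlmann1968, Thm. 1] [cite: Milne1999LefschetzClasses, Thm. 3.2 and Cor. 4.5] [cite: MumfordAV1970, §19 Thm. 1 and p. 169] -/
theorem exists_faceSet_evenSlice_cyclotomic_of_unitTable (K : CMField) [IsCyclotomicExtension {N} ℚ (K : Type)]
    (hN : ∀ r : (ZMod N)ˣ, r * r ≠ -1) (t : (ZMod N)ˣ → A) (ht : ∀ u v, t (u * v) = t u + t v) (ht1 : t (-1) = 0)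
    (htker : ∀ u, t u = 0 → u = 1 ∨ u = -1) (htsurj : Function.Surjective t) (hA : Even (Fintype.card A)) (h4 : 4 ≤ Fintype.card A)
    (σ₀ : (K : Type) →+* ℂ) :
    ∃ 𝒮 : Finset (Face K), 𝒮.card + 1 ≤ Fintype.card (OrbitsA A) ∧
      ((∀ f ∈ 𝒮, ∃ ι₁ : K →+* ℂ, f.Admissible ι₁ ∧ ∃ (V : HermSpace3 K ι₁) (σ : K →+* ℂ),
        (Model.picardCMUniverse exists_isReal_hodgeModel_holds hodgePQ_independent_of_hodgeModel_holds
          BallQuotient.ballQuotientUniformised_holds cmAbelianVarietyRealised_holds).PeriodNV ι₁ V K f.psi σ) →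
      ∀ {P B : AbelianVariety ℂ}, AbelianVariety.IsProductOf (fun B : AbelianVariety ℂ =>
        ∃ (E : Type) (_ : Field E) (_ : NumberField E) (_ : IsCMField E) (_ : E →+* (K : Type)) (Φ : CMType E)
          (ι : 𝓞 E →+* End B) (θ : E →+* Module.End ℂ (complexBetti B.X 1)),
          IsCMTypeRealisation Φ B ι θ) P →
      AVDominatedBy B P → HodgeConjectureFor B.dim B.X) := by
  haveI : IsGalois ℚ (K : Type) := IsCyclotomicExtension.isGalois {N} ℚ (K : Type)
  obtain ⟨c, ε, hcσ, hε, hεc⟩ := exists_autDatum_cyclotomic_of_unitTable (K : Type) hN t ht ht1 htker htsurj σ₀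
  exact exists_faceSet_evenSliceSquares_aut K hA h4 σ₀ ε hε hcσ hεc

end Cyclotomic

end Summit.HodgeConjecture.CorCM.FaceAbelian

end
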